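import Literature.NumberTheory.Automorphic.CuspidalCohomologyGL
import HarnessLib

/-!
# Cohomology of `Res_{K/ℚ} GL_n` with algebraic coefficients, as a Hecke module (`K` a number field)

Topic `NumberTheory/Automorphic`; namespace `Literature.NumberTheory.Automorphic`, grouping
sub-namespace `ResGLnCohomology` (the case `G = Res_{K/ℚ} GL_n` of the generic `TwistedQuotient`
layer of `CuspidalCohomologyGL.lean`, exactly as `GLnCohomology` there is the case `K = ℚ`).

This is the Betti receptacle of Clozel's proof of the algebraicity theorem (Clozel 1990, Thm. 3.13,
proof in §3.5; re-proved as Grobner–Raghuram 2014, §7): for a cuspidal regular algebraic `π` on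
`GL_n(𝔸_K)`, `K` ANY number field, `π_f^{K_f}` occurs in `H^•(S_{K_f}, Ẽ_λ)`, the cohomology of
the adelic locally symmetric space of `G = Res_{K/ℚ} GL_n` with coefficients in the algebraic
representation `E_λ = ⊗_{τ : K ↪ ℂ} V_{λ_τ}` of `G(ℂ) = ∏_τ GL_n(ℂ)`, a finite-dimensional space
defined over the number field `ℚ(λ)`; the tree's `ClozelAlgebraicityHeckeField*Proofs.lean` files
prove that such a receptacle gives the Hecke field, and over `K = ℚ` the receptacle is
`GLnCohomology.levelCohomology`. This file supplies the receptacle for general `K`; nothing is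
asserted about it (no named fact): the realisation of cusp forms in it (Clozel, Lemme 3.15; Borel)
and its finite-dimensionality (Borel–Serre) are published theorems NOT vendored here.

## What is constructed (definitions with bodies, unfolding lemmas; no axioms, no `sorry`)

For a field `k` (the coefficients; `ℂ`, or any field receiving the embeddings of `K`), `n : ℕ` and
a number field `K`:
* `ResGLnCohomology.CoeffModule k n K λ = ⨂_{τ : K →+* k} V_{λ_τ}(k)` for a weight
  `λ : (K →+* k) → (Fin n → ℤ)` (one integral weight per embedding; `V_μ(k)` is the tree's
  `GLnCohomology.CoeffModule k n μ = S_{μ−μ_{n−1}}(kⁿ) ⊗ det^{μ_{n−1}}`), Mathlib `PiTensorProduct`;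
  this is `E_λ` restricted along `G(ℚ) = GL_n(K) ↪ G(k) = ∏_τ GL_n(k)`, `g ↦ (τ(g))_τ`
  [cite: GrobnerRaghuram2014, §7.1 (E_μ = ⊗_v E_{μ_v}, arXiv:1102.1872 numbering)]
  [cite: Clozel1990, §3.5 (p. 122)];
* `coeffRep k n K λ : Representation k (GL (Fin n) K) (CoeffModule k n K λ)`,
  `g · ⊗_τ w_τ = ⊗_τ V_{λ_τ}(τ(g)) w_τ` (`coeffRep_apply_tprod`);
* `glTotPos n K = GL_n(K)⁺`, the elements whose determinant is positive at every real place
  (`mem_glTotPos_iff`; for `K = ℚ` the condition `0 < det`, `mem_glTotPos_iff_of_rat`), and the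
  restrictions `coeffRepPos`, `diagPos : GL_n(K)⁺ →* GL_n(𝔸_K^∞)` (`BigHeckeGLn.globalEmbedding`);
* `level n K 𝔫 = K_f(𝔫) ≤ GL_n(𝔸_K^∞)` (the tree's `finitePrincipalCongruenceLevel`);
* `levelCohomology k n K 𝔫 λ q = H^q(GL_n(K)⁺, Fun(GL_n(𝔸_K^∞)/K_f(𝔫), E_λ(k)))`
  (`TwistedQuotient.cohomology`, Mathlib `groupCohomology`). With `X = G(ℝ)/K_∞°A_G` (`K_∞°` the
  connected maximal compact `∏_{v real} SO(n) × ∏_{v complex} U(n)`, `A_G = ℝ_{>0}` diagonal, the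
  split component of the `ℚ`-split centre), `G(ℚ) = GL_n(K)` permutes the `2^{r_1}` components of
  `X` transitively (signs of `det` at the real places) and `GL_n(K)⁺` is the stabiliser of one, so
  `S_{K_f} = G(ℚ)\(X × G(𝔸_f)/K_f) = GL_n(K)⁺\(X⁺ × G(𝔸_f)/K_f)` with `X⁺` contractible and
  `GL_n(K)⁺` acting with finite isotropy (a central unit fixing a point of `X⁺` has all `|τ(ε)|`
  equal, hence is a root of unity), and for `char k = 0` the group cohomology is the cohomology of
  `S_{K_f(𝔫)}` with coefficients in the local system `Ẽ_λ` — the model already used by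
  `GLnCohomology.levelCohomology` for `K = ℚ` (`RaghuramShahidi2010` §2.2)
  [cite: Schwermer2010, §5.1 and §5.3]. (Grobner–Raghuram divide instead by `K'_∞° ⊇ Z(K_v)°` at
  every archimedean place [cite: GrobnerRaghuram2014, §7.2 (definition of S_{G'})]; Clozel's
  argument only uses that the receptacle is a finite-dimensional Hecke module with a rational
  structure, which is how the proofs companion consumes `levelCohomology`.)
* the Hecke operators `heckeOp k n K 𝔫 λ q g = [K_f(𝔫) g K_f(𝔫)]` (`TwistedQuotient.heckeEnd`) and
  `heckeT k n K 𝔫 λ q v i = T_{v,i}`, `t_{v,i} = diag(ϖ_v,…,ϖ_v,1,…,1)` (`BigHeckeGLn.heckeElement`,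
  `i` entries `ϖ_v`), whose eigenvalue on the spherical vector of an unramified `π_v` with Satake
  parameter `α` is `q_v^{i(n−i)/2} e_i(α)` — the normalisation of `AutomorphicRepData.HasSatakeParamAt`
  and of `heckeEigenvalueOf` (`ClozelAlgebraicity.lean`) [cite: Clozel1990, §3.5 (p. 123)];
  `heckeOp_one`.

## Design notes

* Universes: everything lives in `Type` (Mathlib's `groupCohomology` wants one universe; the index
  type `K →+* k` of the tensor product, `GL (Fin n) K` and `GL_n(𝔸_K^∞)` are in `Type`).
  `CoeffModule` is a `def` with its own (`inferInstanceAs`) instances, as `GLnCohomology.CoeffModule`.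
* `GL_n(K)⁺` rather than `GL_n(K)`: with the full group the real places of odd sign type are lost
  (already for `n = 1`: an algebraic Hecke character whose sign at a real place does not match the
  parity of its weight is not `K^×`-invariant as a twisted function on `𝔸_{K,f}^×`, but it is
  `K^{×,+}`-invariant), exactly as `GLnCohomology` uses `GL_n(ℚ)⁺`.
* The semilinear `Aut(ℂ/K̃)`-symmetry of `levelCohomology ℂ …` (`K̃` the compositum of the `τ(K)`),
  which makes the receptacle usable in Clozel's argument, is assembled in the proofs companion from
  the tree's `TwistedQuotient.cohomologySemimap` and the semilinear functoriality of Weyl modules and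
  `PiTensorProduct`; it is not part of this definitions file.
* NOT here: the `(𝔤, K_∞)`-cohomological realisation of cuspidal `π` (Clozel Lemme 3.14–3.15,
  Borel), finite-dimensionality (Borel–Serre), the boundary / interior part for `Res_{K/ℚ}GL_n`
  (the generic `TwistedQuotient.interiorCohomology` applies verbatim to the poset of proper
  `K`-subspaces; not needed for the Hecke field), and any rationality statement.

## References

* L. Clozel, *Motifs et formes automorphes: applications du principe de fonctorialité*, in:
  Automorphic forms, Shimura varieties, and L-functions I (Ann Arbor 1988), Perspect. Math. 10,
  Academic Press 1990, Thm. 3.13, Lemme 3.14–3.15, §3.5 (pp. 120–123). [Clozel1990]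
* H. Grobner, A. Raghuram, *On some arithmetic properties of automorphic forms of GL_m over a
  division algebra*, Int. J. Number Theory 10 (2014) = arXiv:1102.1872, §7.1 (the spaces
  `S^G_{K_f}`, the sheaves `Ẽ_μ`), Lemma 37–38, Thm. 42. [GrobnerRaghuram2014]
* J. Schwermer, *Geometric cycles, arithmetic groups and their cohomology*, Bull. AMS 47 (2010),
  §5.1, §5.3. [Schwermer2010]
* A. Raghuram, F. Shahidi, *On certain period relations for cusp forms on GL_n*, IMRN (2008),
  §2.2. [RaghuramShahidi2010]
-/

noncomputable section

open scoped TensorProduct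
open NumberField IsDedekindDomain

namespace Literature.NumberTheory.Automorphic

namespace ResGLnCohomology

open GLnCohomology

/-! ### The coefficient modules `E_λ = ⊗_τ V_{λ_τ}` -/

section Coeff

variable (k : Type) [Field k] (n : ℕ) (K : Type) [Field K]

/-- **The coefficient module `E_λ(k) = ⨂_{τ : K →+* k} V_{λ_τ}(k)`** of `Res_{K/ℚ} GL_n` for the
weight `λ = (λ_τ)_τ`, one integral weight `λ_τ : Fin n → ℤ` per ring embedding `τ : K →+* k`
(`V_μ(k) = GLnCohomology.CoeffModule k n μ`, Mathlib `PiTensorProduct` over the index type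
`K →+* k`). A `def` with its own instances (one instance path for all representations on it).
[cite: GrobnerRaghuram2014, §7.1 (E_μ = ⊗_v E_{μ_v})] [cite: Clozel1990, §3.5 (p. 122)] -/
def CoeffModule (lam : (K →+* k) → Fin n → ℤ) : Type :=
  ⨂[k] τ : (K →+* k), GLnCohomology.CoeffModule k n (lam τ)

/-- `E_λ(k)` is an additive group (that of the tensor product). [folklore] -/
instance (lam : (K →+* k) → Fin n → ℤ) : AddCommGroup (CoeffModule k n K lam) :=
  inferInstanceAs (AddCommGroup (⨂[k] τ : (K →+* k), GLnCohomology.CoeffModule k n (lam τ)))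

/-- `E_λ(k)` is a `k`-vector space (that of the tensor product). [folklore] -/
instance (lam : (K →+* k) → Fin n → ℤ) : Module k (CoeffModule k n K lam) :=
  inferInstanceAs (Module k (⨂[k] τ : (K →+* k), GLnCohomology.CoeffModule k n (lam τ)))

variable {k n K}

/-- Pure tensors `⊗_τ w_τ ∈ E_λ(k)` (`PiTensorProduct.tprod`). [folklore] -/
def CoeffModule.tprod {lam : (K →+* k) → Fin n → ℤ}
    (w : ∀ τ : K →+* k, GLnCohomology.CoeffModule k n (lam τ)) : CoeffModule k n K lam :=
  PiTensorProduct.tprod k w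

/-- The identification of `E_λ(k)` with the tensor product it is (the identity map, for users who
want Mathlib's `PiTensorProduct` API). [folklore] -/
def CoeffModule.toPiTensor {lam : (K →+* k) → Fin n → ℤ} (w : CoeffModule k n K lam) :
    ⨂[k] τ : (K →+* k), GLnCohomology.CoeffModule k n (lam τ) :=
  w

/-- Induction on `E_λ(k)`: multiples of pure tensors and sums (`PiTensorProduct.induction_on`).
[folklore] -/
@[elab_as_elim]
protected theorem CoeffModule.induction_on {lam : (K →+* k) → Fin n → ℤ}
    {motive : CoeffModule k n K lam → Prop} (v : CoeffModule k n K lam)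
    (smul_tprod : ∀ (c : k) (w : ∀ τ : K →+* k, GLnCohomology.CoeffModule k n (lam τ)),
      motive (c • CoeffModule.tprod w))
    (add : ∀ v w, motive v → motive w → motive (v + w)) : motive v :=
  PiTensorProduct.induction_on (motive := motive) v smul_tprod add

/-- Two `k`-linear maps out of `E_λ(k)` agreeing on pure tensors are equal (`PiTensorProduct.ext`).
[folklore] -/
theorem CoeffModule.hom_ext {lam : (K →+* k) → Fin n → ℤ} {M : Type} [AddCommGroup M] [Module k M]
    {φ₁ φ₂ : CoeffModule k n K lam →ₗ[k] M}
    (h : ∀ w : ∀ τ : K →+* k, GLnCohomology.CoeffModule k n (lam τ),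
      φ₁ (CoeffModule.tprod w) = φ₂ (CoeffModule.tprod w)) : φ₁ = φ₂ :=
  PiTensorProduct.ext (R := k) (s := fun τ : K →+* k => GLnCohomology.CoeffModule k n (lam τ))
    (MultilinearMap.ext fun w => h w)

variable (k n K)

/-- **`E_λ(k)` as a representation of `GL_n(K)`**: `g` acts on the factor `V_{λ_τ}(k)` through the
embedding `τ : K →+* k` by the tree's `GLnCohomology.coeffRepGL k n λ_τ (τ g)`
(`= (det τg)^{(λ_τ)_{n−1}} S_μ(τ g)`), factorwise on the tensor product
(`PiTensorProduct.mapMonoidHom`): the restriction of `E_λ = ⊗_τ V_{λ_τ}` along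
`GL_n(K) ↪ ∏_τ GL_n(k)`. [cite: GrobnerRaghuram2014, §7.1] [cite: Clozel1990, §3.5 (p. 122)] -/
def coeffRep (lam : (K →+* k) → Fin n → ℤ) : Representation k (GL (Fin n) K) (CoeffModule k n K lam) :=
  show GL (Fin n) K →* Module.End k (⨂[k] τ : (K →+* k), GLnCohomology.CoeffModule k n (lam τ)) from
    PiTensorProduct.mapMonoidHom.comp
      (MonoidHom.pi fun τ : K →+* k =>
        (coeffRepGL k n (lam τ)).comp (Matrix.GeneralLinearGroup.map (τ : K →+* k)))

/-- The action on pure tensors is factorwise: `g · ⊗_τ w_τ = ⊗_τ V_{λ_τ}(τ g) w_τ`. [folklore] -/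
@[simp]
theorem coeffRep_apply_tprod (lam : (K →+* k) → Fin n → ℤ) (g : GL (Fin n) K)
    (w : ∀ τ : K →+* k, GLnCohomology.CoeffModule k n (lam τ)) :
    coeffRep k n K lam g (CoeffModule.tprod w) =
      CoeffModule.tprod fun τ => coeffRepGL k n (lam τ) (Matrix.GeneralLinearGroup.map (τ : K →+* k) g) (w τ) :=
  PiTensorProduct.map_tprod _ _

/-- Unfolding lemma: `coeffRep … g` is `PiTensorProduct.map` of the factor actions. [folklore] -/
theorem coeffRep_apply (lam : (K →+* k) → Fin n → ℤ) (g : GL (Fin n) K) :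
    coeffRep k n K lam g =
      PiTensorProduct.map (R := k) fun τ : K →+* k =>
        (coeffRepGL k n (lam τ) (Matrix.GeneralLinearGroup.map (τ : K →+* k) g) :
          GLnCohomology.CoeffModule k n (lam τ) →ₗ[k] GLnCohomology.CoeffModule k n (lam τ)) :=
  rfl

end Coeff

/-! ### `GL_n(K)⁺`: totally positive determinant -/

section TotPos

variable (n : ℕ) (K : Type) [Field K]

/-- **`GL_n(K)⁺`**, the subgroup of `g ∈ GL_n(K)` with `τ(det g) > 0` at every real embedding
`τ : K →+* ℝ` (intersection over `τ` of the preimages of Mathlib's `Matrix.GLPos (Fin n) ℝ`): the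
stabiliser in `G(ℚ) = GL_n(K)` of a connected component of `G(ℝ)/K_∞°A_G`. For `K` with no real
place this is all of `GL_n(K)`. [cite: GrobnerRaghuram2014, §7.1] [cite: RaghuramShahidi2010, §2.2] -/
def glTotPos : Subgroup (GL (Fin n) K) :=
  ⨅ τ : K →+* ℝ, (Matrix.GLPos (Fin n) ℝ).comap (Matrix.GeneralLinearGroup.map τ)

variable {n K}

/-- Membership in `GL_n(K)⁺`: `0 < τ(det g)` for every real embedding `τ`. [folklore] -/
theorem mem_glTotPos_iff (g : GL (Fin n) K) :
    g ∈ glTotPos n K ↔ ∀ τ : K →+* ℝ, 0 < τ ((Matrix.GeneralLinearGroup.det g : Kˣ) : K) := by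
  simp only [glTotPos, Subgroup.mem_iInf, Subgroup.mem_comap, Matrix.mem_glpos,
    Matrix.GeneralLinearGroup.map_det, Units.coe_map, MonoidHom.coe_coe]

/-- If `K` has no real embedding (e.g. `K` totally imaginary), `GL_n(K)⁺ = GL_n(K)`. [folklore] -/
theorem glTotPos_eq_top [IsEmpty (K →+* ℝ)] : glTotPos n K = ⊤ := by
  refine eq_top_iff.mpr fun g _ => (mem_glTotPos_iff g).mpr fun τ => ?_
  exact isEmptyElim τ

/-- For `K = ℚ`: `g ∈ GL_n(ℚ)⁺ ↔ 0 < det g` (the unique real embedding is the cast), i.e.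
`glTotPos n ℚ` is Mathlib's `Matrix.GLPos (Fin n) ℚ`. [folklore] -/
theorem mem_glTotPos_iff_of_rat (g : GL (Fin n) ℚ) :
    g ∈ glTotPos n ℚ ↔ 0 < ((Matrix.GeneralLinearGroup.det g : ℚˣ) : ℚ) := by
  rw [mem_glTotPos_iff]
  constructor
  · intro h
    have h1 := h (Rat.castHom ℝ)
    rwa [Rat.coe_castHom, Rat.cast_pos] at h1
  · intro h τ
    rw [Subsingleton.elim τ (Rat.castHom ℝ), Rat.coe_castHom, Rat.cast_pos]
    exact h

/-- `glTotPos n ℚ = Matrix.GLPos (Fin n) ℚ`. [folklore] -/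
theorem glTotPos_rat_eq (n : ℕ) : glTotPos n ℚ = Matrix.GLPos (Fin n) ℚ :=
  Subgroup.ext fun g => (mem_glTotPos_iff_of_rat g).trans (Matrix.mem_glpos g).symm

end TotPos

/-! ### `E_λ` on `GL_n(K)⁺` -/

section CoeffPos

variable (k : Type) [Field k] (n : ℕ) (K : Type) [Field K]

/-- `E_λ(k)` as a representation of `GL_n(K)⁺` (restriction of `coeffRep`), the group `Γ` of the
model `S_{K_f} = GL_n(K)⁺\(X⁺ × GL_n(𝔸_K^∞)/K_f)`. [cite: GrobnerRaghuram2014, §7.1] -/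
def coeffRepPos (lam : (K →+* k) → Fin n → ℤ) :
    Representation k (glTotPos n K) (CoeffModule k n K lam) :=
  (coeffRep k n K lam).comp (glTotPos n K).subtype

/-- Unfolding lemma: `coeffRepPos … γ = coeffRep … ↑γ`. [folklore] -/
@[simp]
theorem coeffRepPos_apply (lam : (K →+* k) → Fin n → ℤ) (γ : glTotPos n K) :
    coeffRepPos k n K lam γ = coeffRep k n K lam (γ : GL (Fin n) K) :=
  rfl

end CoeffPos

/-! ### The level `K_f(𝔫)` and `H^q(S_{K_f(𝔫)}, Ẽ_λ)` -/

section Level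

variable (k : Type) [Field k] (n : ℕ) (K : Type) [Field K] [NumberField K]

variable {k} in
/-- The diagonal embedding `GL_n(K)⁺ →* GL_n(𝔸_K^∞)` (restriction of `BigHeckeGLn.globalEmbedding`).
[folklore] -/
abbrev diagPos : glTotPos n K →* BigHeckeGLn.FiniteAdelicGL n K :=
  (BigHeckeGLn.globalEmbedding n K).comp (glTotPos n K).subtype

variable {k} in
/-- The level `K_f(𝔫) ≤ GL_n(𝔸_K^∞)`: the finite part of the principal congruence subgroup of level
`𝔫` (the tree's `finitePrincipalCongruenceLevel`). [cite: GrobnerRaghuram2014, §7.1] -/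
abbrev level (𝔫 : Ideal (𝓞 K)) : Subgroup (BigHeckeGLn.FiniteAdelicGL n K) :=
  finitePrincipalCongruenceLevel n K 𝔫

/-- **`H^q(S_{K_f(𝔫)}, Ẽ_λ(k)) := H^q(GL_n(K)⁺, Fun(GL_n(𝔸_K^∞)/K_f(𝔫), E_λ(k)))`**, the
cohomology of the adelic locally symmetric space of `Res_{K/ℚ} GL_n` of level `K_f(𝔫)`,
`S_{K_f} = G(ℚ)\(G(ℝ)/K_∞°A_G × G(𝔸_f)/K_f) = GL_n(K)⁺\(X⁺ × G(𝔸_f)/K_f)` (`X⁺` contractible,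
finite isotropy), with coefficients in the local system `Ẽ_λ` of `E_λ = ⊗_τ V_{λ_τ}`, in the tree's
model `TwistedQuotient.cohomology` (Mathlib `groupCohomology` of the twisted coefficient module).
[cite: Schwermer2010, §5.1 and §5.3] [cite: GrobnerRaghuram2014, §7.2 (H^q(S_{G'}, ℰ_μ))]
[cite: Clozel1990, §3.5 (p. 122)] -/
abbrev levelCohomology (𝔫 : Ideal (𝓞 K)) (lam : (K →+* k) → Fin n → ℤ) (q : ℕ) : ModuleCat k :=
  TwistedQuotient.cohomology (V := CoeffModule k n K lam) (diagPos n K) (level n K 𝔫)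
    (coeffRepPos k n K lam) q

/-- The Hecke operator `T_g = [K_f(𝔫) g K_f(𝔫)]`, `g ∈ GL_n(𝔸_K^∞)`, on `H^q(S_{K_f(𝔫)}, Ẽ_λ(k))`
(`TwistedQuotient.heckeEnd`: functoriality of group cohomology applied to
`(T_g f)(xK_f) = ∑_{hK_f ⊆ K_f g K_f} f(xhK_f)`). [cite: GrobnerRaghuram2014, §7.1] -/
abbrev heckeOp (𝔫 : Ideal (𝓞 K)) (lam : (K →+* k) → Fin n → ℤ) (q : ℕ)
    (g : BigHeckeGLn.FiniteAdelicGL n K) : Module.End k (levelCohomology k n K 𝔫 lam q) :=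
  TwistedQuotient.heckeEnd (V := CoeffModule k n K lam) (diagPos n K) (level n K 𝔫)
    (coeffRepPos k n K lam) g q

/-- **The unramified Hecke operator `T_{v,i} = [K_f(𝔫) t_{v,i} K_f(𝔫)]`**,
`t_{v,i} = diag(ϖ_v,…,ϖ_v,1,…,1)` with `i` entries `ϖ_v` (`BigHeckeGLn.heckeElement`, a fixed
uniformiser), acting on the spherical vector of an unramified `π_v` with Satake parameter `α` by
`q_v^{i(n−i)/2} e_i(α)` (the normalisation of `heckeEigenvalueOf`). [cite: Clozel1990, §3.5 (p. 123)] -/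
abbrev heckeT (𝔫 : Ideal (𝓞 K)) (lam : (K →+* k) → Fin n → ℤ) (q : ℕ)
    (v : HeightOneSpectrum (𝓞 K)) (i : ℕ) : Module.End k (levelCohomology k n K 𝔫 lam q) :=
  heckeOp k n K 𝔫 lam q (BigHeckeGLn.heckeElement n K v i)

/-- `T_1 = id`. [folklore] -/
theorem heckeOp_one (𝔫 : Ideal (𝓞 K)) (lam : (K →+* k) → Fin n → ℤ) (q : ℕ) :
    heckeOp k n K 𝔫 lam q 1 = LinearMap.id := by
  simp only [heckeOp, TwistedQuotient.heckeEnd, TwistedQuotient.heckeOperator_one, ModuleCat.hom_id]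

end Level

end ResGLnCohomology

end Literature.NumberTheory.Automorphic

end
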